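import Summits.Ventures.CertifiedManyBodySolver.Downfold.EmeryChargeTransferSlopeBox
import Summits.Ventures.CertifiedManyBodySolver.Downfold.EmeryScaleBoxHg1201NH1125Pts
import Summits.Ventures.CertifiedManyBodySolver.Downfold.EmeryScaleBoxHg1201NH116Pts
import Summits.Ventures.CertifiedManyBodySolver.Downfold.EmeryScaleBoxLa214X0125Pts
import Summits.Ventures.CertifiedManyBodySolver.Downfold.EmeryScaleBoxLa214X022Pts
import Summits.Ventures.CertifiedManyBodySolver.Downfold.EmeryScaleBoxLa214X0Pts
import HarnessLib

/-!
# THE FERMI-ENERGY SLOPE IN Δ_pd OVER THE TYPED BOXES #18 (La₂CuO₄) AND #19 (HgBa₂CuO₄): `−1 ≤ dε_F/dΔ_pd ≤ −κ` with κ ≈ 0.16–0.21 certified per (box, filling)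
# (INFL-3to1-B §B.90 (i); kernel `EmeryChargeTransferSlopeBox.fermiEnergyOf_slope_law`; the lower slope bound −1 is `EmeryChargeTransferLipschitz`, §B.83)

Venture CertifiedManyBodySolver, cell `pub/hubbard-downfold` (stage S1), seat hubbard-downfold-mod-4 (technique B, g38); namespace
`Summit.Ventures.CertifiedManyBodySolver.Downfold.Emery`. Everything PROVED (0 sorry; no new decide — the FL/TP brackets of the g36/g37 scale census are re-read).
WHAT THIS IS NOT: a statement about the materials (SCREENING-GRADE typed boxes); `U = 0` one-body kinematics of the σ model. READING: raising the charge-transfer energy across box #18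
lowers the σ Fermi level (at fixed doping) by at least κ eV per eV — the energy channel that a fixed-FILLING antinodal lever needs (successor of §B.90 (h)); κ is read from the
universal Cu-d weight ceiling (`1 − κ` ≈ the largest Cu weight on any member's Fermi surface) and is NOT sharp (the true slope is −⟨1 − w_d⟩_FS ≈ −0.3).

| box | filling | E_l (bottom ε_F) | E_h (top ε_F) | ceiling at E_low = E_l − 0.01 | **κ** | **drop κ(Δ₂ − Δ₁)** |
|---|---|---|---|---|---|---|
| La214ALL | x0 | 1.2489 | 2.435 | 0.8264 | **0.172** | 0.3956 eV |
| La214ALL | x0125 | 1.1653 | 2.2616 | 0.8328 | **0.166** | 0.3818 eV |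
| La214ALL | x022 | 1.118 | 2.1567 | 0.8366 | **0.162** | 0.3726 eV |
| Hg1201 | nH1125 | 1.2136 | 2.0445 | 0.7936 | **0.205** | 0.2255 eV |
| Hg1201 | nH116 | 1.1854 | 1.995 | 0.7952 | **0.203** | 0.2233 eV |

Sources: three-band model [HybertsenSchluterChristensen1989, Eq. (1)]; Hellmann–Feynman [folklore]; [folklore] analysis.
-/

noncomputable section

namespace Summit.Ventures.CertifiedManyBodySolver.Downfold.Emery

open Real Set

/-- **`emeryBoxLa214v123`, x = 0 (ν = 1/2): for every `(t_pd, t_pp, t_pp′)` of the box the Fermi energy at `Δ_pd = 4` lies at least `0.3956` below the one at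
`Δ_pd = 1.7` — slope `dε_F/dΔ ≤ −0.172`** (`κ = 43/250` from the axis ceiling `dWeightAxisCF(4, 1.29, 0.15; E_low = 1.2389) = 0.8264`; brackets
`scalePt_La214X0_FL_br` / `scalePt_La214X0_TP_br`). Together with `EmeryChargeTransferLipschitz`: `−1 ≤ slope ≤ −0.172` on this box. [folklore] -/
theorem la214Box_fermiEnergy_slope_x0 {a b c : ℝ} (ha : a ∈ Icc ((129 : ℝ) / 100) ((38 : ℝ) / 25)) (hb : b ∈ Icc ((23 : ℝ) / 50) ((33 : ℝ) / 50)) (hc : c ∈ Icc ((3 : ℝ) / 25) ((3 : ℝ) / 20)) :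
    fermiEnergyOf (4 : ℝ) a b c ((1 : ℝ) / 2) + ((43 : ℝ) / 250) * ((4 : ℝ) - ((17 : ℝ) / 10)) ≤ fermiEnergyOf ((17 : ℝ) / 10) a b c ((1 : ℝ) / 2) := by
  have hF := (fermiEnergyOf_of_pointBracketCheck scalePt_La214X0_FL_br (by norm_num) (by norm_num) (by norm_num) (ν := (1/2 : ℝ))
    (by push_cast; exact ⟨le_rfl, le_rfl⟩)).2
  have hT := (fermiEnergyOf_of_pointBracketCheck scalePt_La214X0_TP_br (by norm_num) (by norm_num) (by norm_num) (ν := (1/2 : ℝ))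
    (by push_cast; exact ⟨le_rfl, le_rfl⟩)).2
  push_cast at hF hT
  have ha0 : 0 < a := lt_of_lt_of_le (by norm_num) ha.1
  have hc0 : 0 ≤ c := le_trans (by norm_num) hc.1
  -- the box's bottom / top Fermi energies at this (a, b, c)
  have hlo := (fermiEnergyOf_mem_Icc_of_mem_box' (Δ₁ := ((17 : ℝ) / 10)) (Δ₂ := (4 : ℝ)) (a₁ := ((129 : ℝ) / 100)) (a₂ := ((38 : ℝ) / 25)) (b₁ := ((23 : ℝ) / 50)) (b₂ := ((33 : ℝ) / 50)) (c₁ := ((3 : ℝ) / 25)) (c₂ := ((3 : ℝ) / 20))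
    (Δ := (4 : ℝ)) (ν := ((1 : ℝ) / 2)) (by norm_num) (by norm_num) (by norm_num) (by norm_num) ⟨by norm_num, le_rfl⟩ ha hb hc (by norm_num) (by norm_num)).1
  have hhi := (fermiEnergyOf_mem_Icc_of_mem_box' (Δ₁ := ((17 : ℝ) / 10)) (Δ₂ := (4 : ℝ)) (a₁ := ((129 : ℝ) / 100)) (a₂ := ((38 : ℝ) / 25)) (b₁ := ((23 : ℝ) / 50)) (b₂ := ((33 : ℝ) / 50)) (c₁ := ((3 : ℝ) / 25)) (c₂ := ((3 : ℝ) / 20))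
    (Δ := ((17 : ℝ) / 10)) (ν := ((1 : ℝ) / 2)) (by norm_num) (by norm_num) (by norm_num) (by norm_num) ⟨le_rfl, by norm_num⟩ ha hb hc (by norm_num) (by norm_num)).2
  -- the axis ceiling at this (a, c) is below the corner value
  have hW : dWeightAxisCF (4 : ℝ) a c ((12389 : ℝ) / 10000) ≤ dWeightAxisCF (4 : ℝ) ((129 : ℝ) / 100) ((3 : ℝ) / 20) ((12389 : ℝ) / 10000) :=
    calc dWeightAxisCF (4 : ℝ) a c ((12389 : ℝ) / 10000) ≤ dWeightAxisCF (4 : ℝ) ((129 : ℝ) / 100) c ((12389 : ℝ) / 10000) :=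
          dWeightAxisCF_anti_tpd (by norm_num) (by norm_num) ha.1 (by norm_num) hc0 (by nlinarith [hc.2])
      _ ≤ dWeightAxisCF (4 : ℝ) ((129 : ℝ) / 100) ((3 : ℝ) / 20) ((12389 : ℝ) / 10000) := dWeightAxisCF_mono_tppP (by norm_num) (by norm_num) hc0 hc.2 (by norm_num)
  have hWn : dWeightAxisCF (4 : ℝ) ((129 : ℝ) / 100) ((3 : ℝ) / 20) ((12389 : ℝ) / 10000) ≤ ((1033 : ℝ) / 1250) := by norm_num [dWeightAxisCF]
  exact fermiEnergyOf_slope_law (Elow := ((12389 : ℝ) / 10000)) (El := ((12489 : ℝ) / 10000)) (Eh := ((487 : ℝ) / 200)) (by norm_num) (by norm_num) ha0.ne' hc0 ((hc.2.trans (by norm_num)).trans hb.1)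
    (lt_of_lt_of_le (by norm_num) hb.1) (by norm_num) (by norm_num) (by norm_num) (by norm_num) (hF.1.trans hlo) (hhi.trans hT.2)
    (by nlinarith [hc.2, ha.1]) (by nlinarith [hc.2, ha.1]) (by nlinarith [hc.2, ha.1]) (by norm_num) (by linarith)

/-- **`emeryBoxLa214v123`, x = 1/8 (ν = 7/16): for every `(t_pd, t_pp, t_pp′)` of the box the Fermi energy at `Δ_pd = 4` lies at least `0.3818` below the one at
`Δ_pd = 1.7` — slope `dε_F/dΔ ≤ −0.166`** (`κ = 83/500` from the axis ceiling `dWeightAxisCF(4, 1.29, 0.15; E_low = 1.1553) = 0.8328`; brackets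
`scalePt_La214X0125_FL_br` / `scalePt_La214X0125_TP_br`). Together with `EmeryChargeTransferLipschitz`: `−1 ≤ slope ≤ −0.166` on this box. [folklore] -/
theorem la214Box_fermiEnergy_slope_x0125 {a b c : ℝ} (ha : a ∈ Icc ((129 : ℝ) / 100) ((38 : ℝ) / 25)) (hb : b ∈ Icc ((23 : ℝ) / 50) ((33 : ℝ) / 50)) (hc : c ∈ Icc ((3 : ℝ) / 25) ((3 : ℝ) / 20)) :
    fermiEnergyOf (4 : ℝ) a b c ((7 : ℝ) / 16) + ((83 : ℝ) / 500) * ((4 : ℝ) - ((17 : ℝ) / 10)) ≤ fermiEnergyOf ((17 : ℝ) / 10) a b c ((7 : ℝ) / 16) := by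
  have hF := (fermiEnergyOf_of_pointBracketCheck scalePt_La214X0125_FL_br (by norm_num) (by norm_num) (by norm_num) (ν := (7/16 : ℝ))
    (by push_cast; exact ⟨le_rfl, le_rfl⟩)).2
  have hT := (fermiEnergyOf_of_pointBracketCheck scalePt_La214X0125_TP_br (by norm_num) (by norm_num) (by norm_num) (ν := (7/16 : ℝ))
    (by push_cast; exact ⟨le_rfl, le_rfl⟩)).2
  push_cast at hF hT
  have ha0 : 0 < a := lt_of_lt_of_le (by norm_num) ha.1
  have hc0 : 0 ≤ c := le_trans (by norm_num) hc.1
  -- the box's bottom / top Fermi energies at this (a, b, c)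
  have hlo := (fermiEnergyOf_mem_Icc_of_mem_box' (Δ₁ := ((17 : ℝ) / 10)) (Δ₂ := (4 : ℝ)) (a₁ := ((129 : ℝ) / 100)) (a₂ := ((38 : ℝ) / 25)) (b₁ := ((23 : ℝ) / 50)) (b₂ := ((33 : ℝ) / 50)) (c₁ := ((3 : ℝ) / 25)) (c₂ := ((3 : ℝ) / 20))
    (Δ := (4 : ℝ)) (ν := ((7 : ℝ) / 16)) (by norm_num) (by norm_num) (by norm_num) (by norm_num) ⟨by norm_num, le_rfl⟩ ha hb hc (by norm_num) (by norm_num)).1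
  have hhi := (fermiEnergyOf_mem_Icc_of_mem_box' (Δ₁ := ((17 : ℝ) / 10)) (Δ₂ := (4 : ℝ)) (a₁ := ((129 : ℝ) / 100)) (a₂ := ((38 : ℝ) / 25)) (b₁ := ((23 : ℝ) / 50)) (b₂ := ((33 : ℝ) / 50)) (c₁ := ((3 : ℝ) / 25)) (c₂ := ((3 : ℝ) / 20))
    (Δ := ((17 : ℝ) / 10)) (ν := ((7 : ℝ) / 16)) (by norm_num) (by norm_num) (by norm_num) (by norm_num) ⟨le_rfl, by norm_num⟩ ha hb hc (by norm_num) (by norm_num)).2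
  -- the axis ceiling at this (a, c) is below the corner value
  have hW : dWeightAxisCF (4 : ℝ) a c ((11553 : ℝ) / 10000) ≤ dWeightAxisCF (4 : ℝ) ((129 : ℝ) / 100) ((3 : ℝ) / 20) ((11553 : ℝ) / 10000) :=
    calc dWeightAxisCF (4 : ℝ) a c ((11553 : ℝ) / 10000) ≤ dWeightAxisCF (4 : ℝ) ((129 : ℝ) / 100) c ((11553 : ℝ) / 10000) :=
          dWeightAxisCF_anti_tpd (by norm_num) (by norm_num) ha.1 (by norm_num) hc0 (by nlinarith [hc.2])
      _ ≤ dWeightAxisCF (4 : ℝ) ((129 : ℝ) / 100) ((3 : ℝ) / 20) ((11553 : ℝ) / 10000) := dWeightAxisCF_mono_tppP (by norm_num) (by norm_num) hc0 hc.2 (by norm_num)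
  have hWn : dWeightAxisCF (4 : ℝ) ((129 : ℝ) / 100) ((3 : ℝ) / 20) ((11553 : ℝ) / 10000) ≤ ((83281 : ℝ) / 100000) := by norm_num [dWeightAxisCF]
  exact fermiEnergyOf_slope_law (Elow := ((11553 : ℝ) / 10000)) (El := ((11653 : ℝ) / 10000)) (Eh := ((2827 : ℝ) / 1250)) (by norm_num) (by norm_num) ha0.ne' hc0 ((hc.2.trans (by norm_num)).trans hb.1)
    (lt_of_lt_of_le (by norm_num) hb.1) (by norm_num) (by norm_num) (by norm_num) (by norm_num) (hF.1.trans hlo) (hhi.trans hT.2)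
    (by nlinarith [hc.2, ha.1]) (by nlinarith [hc.2, ha.1]) (by nlinarith [hc.2, ha.1]) (by norm_num) (by linarith)

/-- **`emeryBoxLa214v123`, x = 0.22 (ν = 39/100): for every `(t_pd, t_pp, t_pp′)` of the box the Fermi energy at `Δ_pd = 4` lies at least `0.3726` below the one at
`Δ_pd = 1.7` — slope `dε_F/dΔ ≤ −0.162`** (`κ = 81/500` from the axis ceiling `dWeightAxisCF(4, 1.29, 0.15; E_low = 1.108) = 0.8366`; brackets
`scalePt_La214X022_FL_br` / `scalePt_La214X022_TP_br`). Together with `EmeryChargeTransferLipschitz`: `−1 ≤ slope ≤ −0.162` on this box. [folklore] -/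
theorem la214Box_fermiEnergy_slope_x022 {a b c : ℝ} (ha : a ∈ Icc ((129 : ℝ) / 100) ((38 : ℝ) / 25)) (hb : b ∈ Icc ((23 : ℝ) / 50) ((33 : ℝ) / 50)) (hc : c ∈ Icc ((3 : ℝ) / 25) ((3 : ℝ) / 20)) :
    fermiEnergyOf (4 : ℝ) a b c ((39 : ℝ) / 100) + ((81 : ℝ) / 500) * ((4 : ℝ) - ((17 : ℝ) / 10)) ≤ fermiEnergyOf ((17 : ℝ) / 10) a b c ((39 : ℝ) / 100) := by
  have hF := (fermiEnergyOf_of_pointBracketCheck scalePt_La214X022_FL_br (by norm_num) (by norm_num) (by norm_num) (ν := (39/100 : ℝ))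
    (by push_cast; exact ⟨le_rfl, le_rfl⟩)).2
  have hT := (fermiEnergyOf_of_pointBracketCheck scalePt_La214X022_TP_br (by norm_num) (by norm_num) (by norm_num) (ν := (39/100 : ℝ))
    (by push_cast; exact ⟨le_rfl, le_rfl⟩)).2
  push_cast at hF hT
  have ha0 : 0 < a := lt_of_lt_of_le (by norm_num) ha.1
  have hc0 : 0 ≤ c := le_trans (by norm_num) hc.1
  -- the box's bottom / top Fermi energies at this (a, b, c)
  have hlo := (fermiEnergyOf_mem_Icc_of_mem_box' (Δ₁ := ((17 : ℝ) / 10)) (Δ₂ := (4 : ℝ)) (a₁ := ((129 : ℝ) / 100)) (a₂ := ((38 : ℝ) / 25)) (b₁ := ((23 : ℝ) / 50)) (b₂ := ((33 : ℝ) / 50)) (c₁ := ((3 : ℝ) / 25)) (c₂ := ((3 : ℝ) / 20))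
    (Δ := (4 : ℝ)) (ν := ((39 : ℝ) / 100)) (by norm_num) (by norm_num) (by norm_num) (by norm_num) ⟨by norm_num, le_rfl⟩ ha hb hc (by norm_num) (by norm_num)).1
  have hhi := (fermiEnergyOf_mem_Icc_of_mem_box' (Δ₁ := ((17 : ℝ) / 10)) (Δ₂ := (4 : ℝ)) (a₁ := ((129 : ℝ) / 100)) (a₂ := ((38 : ℝ) / 25)) (b₁ := ((23 : ℝ) / 50)) (b₂ := ((33 : ℝ) / 50)) (c₁ := ((3 : ℝ) / 25)) (c₂ := ((3 : ℝ) / 20))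
    (Δ := ((17 : ℝ) / 10)) (ν := ((39 : ℝ) / 100)) (by norm_num) (by norm_num) (by norm_num) (by norm_num) ⟨le_rfl, by norm_num⟩ ha hb hc (by norm_num) (by norm_num)).2
  -- the axis ceiling at this (a, c) is below the corner value
  have hW : dWeightAxisCF (4 : ℝ) a c ((277 : ℝ) / 250) ≤ dWeightAxisCF (4 : ℝ) ((129 : ℝ) / 100) ((3 : ℝ) / 20) ((277 : ℝ) / 250) :=
    calc dWeightAxisCF (4 : ℝ) a c ((277 : ℝ) / 250) ≤ dWeightAxisCF (4 : ℝ) ((129 : ℝ) / 100) c ((277 : ℝ) / 250) :=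
          dWeightAxisCF_anti_tpd (by norm_num) (by norm_num) ha.1 (by norm_num) hc0 (by nlinarith [hc.2])
      _ ≤ dWeightAxisCF (4 : ℝ) ((129 : ℝ) / 100) ((3 : ℝ) / 20) ((277 : ℝ) / 250) := dWeightAxisCF_mono_tppP (by norm_num) (by norm_num) hc0 hc.2 (by norm_num)
  have hWn : dWeightAxisCF (4 : ℝ) ((129 : ℝ) / 100) ((3 : ℝ) / 20) ((277 : ℝ) / 250) ≤ ((16733 : ℝ) / 20000) := by norm_num [dWeightAxisCF]
  exact fermiEnergyOf_slope_law (Elow := ((277 : ℝ) / 250)) (El := ((559 : ℝ) / 500)) (Eh := ((21567 : ℝ) / 10000)) (by norm_num) (by norm_num) ha0.ne' hc0 ((hc.2.trans (by norm_num)).trans hb.1)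
    (lt_of_lt_of_le (by norm_num) hb.1) (by norm_num) (by norm_num) (by norm_num) (by norm_num) (hF.1.trans hlo) (hhi.trans hT.2)
    (by nlinarith [hc.2, ha.1]) (by nlinarith [hc.2, ha.1]) (by nlinarith [hc.2, ha.1]) (by norm_num) (by linarith)

/-- **`emeryBoxHg1201 (EmeryBoxesCuprates)`, n_H = 1.125 (ν = 7/16): for every `(t_pd, t_pp, t_pp′)` of the box the Fermi energy at `Δ_pd = 2.5` lies at least `0.2255` below the one at
`Δ_pd = 1.4` — slope `dε_F/dΔ ≤ −0.205`** (`κ = 41/200` from the axis ceiling `dWeightAxisCF(2.5, 1.12, 0.208; E_low = 1.2036) = 0.7936`; brackets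
`scalePt_Hg1201NH1125_FL_br` / `scalePt_Hg1201NH1125_TP_br`). Together with `EmeryChargeTransferLipschitz`: `−1 ≤ slope ≤ −0.205` on this box. [folklore] -/
theorem hg1201Box_fermiEnergy_slope_nH1125 {a b c : ℝ} (ha : a ∈ Icc ((28 : ℝ) / 25) ((33 : ℝ) / 25)) (hb : b ∈ Icc ((16 : ℝ) / 25) ((17 : ℝ) / 20)) (hc : c ∈ Icc ((161 : ℝ) / 1000) ((26 : ℝ) / 125)) :
    fermiEnergyOf ((5 : ℝ) / 2) a b c ((7 : ℝ) / 16) + ((41 : ℝ) / 200) * (((5 : ℝ) / 2) - ((7 : ℝ) / 5)) ≤ fermiEnergyOf ((7 : ℝ) / 5) a b c ((7 : ℝ) / 16) := by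
  have hF := (fermiEnergyOf_of_pointBracketCheck scalePt_Hg1201NH1125_FL_br (by norm_num) (by norm_num) (by norm_num) (ν := (7/16 : ℝ))
    (by push_cast; exact ⟨le_rfl, le_rfl⟩)).2
  have hT := (fermiEnergyOf_of_pointBracketCheck scalePt_Hg1201NH1125_TP_br (by norm_num) (by norm_num) (by norm_num) (ν := (7/16 : ℝ))
    (by push_cast; exact ⟨le_rfl, le_rfl⟩)).2
  push_cast at hF hT
  have ha0 : 0 < a := lt_of_lt_of_le (by norm_num) ha.1
  have hc0 : 0 ≤ c := le_trans (by norm_num) hc.1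
  -- the box's bottom / top Fermi energies at this (a, b, c)
  have hlo := (fermiEnergyOf_mem_Icc_of_mem_box' (Δ₁ := ((7 : ℝ) / 5)) (Δ₂ := ((5 : ℝ) / 2)) (a₁ := ((28 : ℝ) / 25)) (a₂ := ((33 : ℝ) / 25)) (b₁ := ((16 : ℝ) / 25)) (b₂ := ((17 : ℝ) / 20)) (c₁ := ((161 : ℝ) / 1000)) (c₂ := ((26 : ℝ) / 125))
    (Δ := ((5 : ℝ) / 2)) (ν := ((7 : ℝ) / 16)) (by norm_num) (by norm_num) (by norm_num) (by norm_num) ⟨by norm_num, le_rfl⟩ ha hb hc (by norm_num) (by norm_num)).1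
  have hhi := (fermiEnergyOf_mem_Icc_of_mem_box' (Δ₁ := ((7 : ℝ) / 5)) (Δ₂ := ((5 : ℝ) / 2)) (a₁ := ((28 : ℝ) / 25)) (a₂ := ((33 : ℝ) / 25)) (b₁ := ((16 : ℝ) / 25)) (b₂ := ((17 : ℝ) / 20)) (c₁ := ((161 : ℝ) / 1000)) (c₂ := ((26 : ℝ) / 125))
    (Δ := ((7 : ℝ) / 5)) (ν := ((7 : ℝ) / 16)) (by norm_num) (by norm_num) (by norm_num) (by norm_num) ⟨le_rfl, by norm_num⟩ ha hb hc (by norm_num) (by norm_num)).2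
  -- the axis ceiling at this (a, c) is below the corner value
  have hW : dWeightAxisCF ((5 : ℝ) / 2) a c ((3009 : ℝ) / 2500) ≤ dWeightAxisCF ((5 : ℝ) / 2) ((28 : ℝ) / 25) ((26 : ℝ) / 125) ((3009 : ℝ) / 2500) :=
    calc dWeightAxisCF ((5 : ℝ) / 2) a c ((3009 : ℝ) / 2500) ≤ dWeightAxisCF ((5 : ℝ) / 2) ((28 : ℝ) / 25) c ((3009 : ℝ) / 2500) :=
          dWeightAxisCF_anti_tpd (by norm_num) (by norm_num) ha.1 (by norm_num) hc0 (by nlinarith [hc.2])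
      _ ≤ dWeightAxisCF ((5 : ℝ) / 2) ((28 : ℝ) / 25) ((26 : ℝ) / 125) ((3009 : ℝ) / 2500) := dWeightAxisCF_mono_tppP (by norm_num) (by norm_num) hc0 hc.2 (by norm_num)
  have hWn : dWeightAxisCF ((5 : ℝ) / 2) ((28 : ℝ) / 25) ((26 : ℝ) / 125) ((3009 : ℝ) / 2500) ≤ ((39679 : ℝ) / 50000) := by norm_num [dWeightAxisCF]
  exact fermiEnergyOf_slope_law (Elow := ((3009 : ℝ) / 2500)) (El := ((1517 : ℝ) / 1250)) (Eh := ((4089 : ℝ) / 2000)) (by norm_num) (by norm_num) ha0.ne' hc0 ((hc.2.trans (by norm_num)).trans hb.1)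
    (lt_of_lt_of_le (by norm_num) hb.1) (by norm_num) (by norm_num) (by norm_num) (by norm_num) (hF.1.trans hlo) (hhi.trans hT.2)
    (by nlinarith [hc.2, ha.1]) (by nlinarith [hc.2, ha.1]) (by nlinarith [hc.2, ha.1]) (by norm_num) (by linarith)

/-- **`emeryBoxHg1201 (EmeryBoxesCuprates)`, n_H = 1.16 (ν = 21/50): for every `(t_pd, t_pp, t_pp′)` of the box the Fermi energy at `Δ_pd = 2.5` lies at least `0.2233` below the one at
`Δ_pd = 1.4` — slope `dε_F/dΔ ≤ −0.203`** (`κ = 203/1000` from the axis ceiling `dWeightAxisCF(2.5, 1.12, 0.208; E_low = 1.1754) = 0.7952`; brackets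
`scalePt_Hg1201NH116_FL_br` / `scalePt_Hg1201NH116_TP_br`). Together with `EmeryChargeTransferLipschitz`: `−1 ≤ slope ≤ −0.203` on this box. [folklore] -/
theorem hg1201Box_fermiEnergy_slope_nH116 {a b c : ℝ} (ha : a ∈ Icc ((28 : ℝ) / 25) ((33 : ℝ) / 25)) (hb : b ∈ Icc ((16 : ℝ) / 25) ((17 : ℝ) / 20)) (hc : c ∈ Icc ((161 : ℝ) / 1000) ((26 : ℝ) / 125)) :
    fermiEnergyOf ((5 : ℝ) / 2) a b c ((21 : ℝ) / 50) + ((203 : ℝ) / 1000) * (((5 : ℝ) / 2) - ((7 : ℝ) / 5)) ≤ fermiEnergyOf ((7 : ℝ) / 5) a b c ((21 : ℝ) / 50) := by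
  have hF := (fermiEnergyOf_of_pointBracketCheck scalePt_Hg1201NH116_FL_br (by norm_num) (by norm_num) (by norm_num) (ν := (21/50 : ℝ))
    (by push_cast; exact ⟨le_rfl, le_rfl⟩)).2
  have hT := (fermiEnergyOf_of_pointBracketCheck scalePt_Hg1201NH116_TP_br (by norm_num) (by norm_num) (by norm_num) (ν := (21/50 : ℝ))
    (by push_cast; exact ⟨le_rfl, le_rfl⟩)).2
  push_cast at hF hT
  have ha0 : 0 < a := lt_of_lt_of_le (by norm_num) ha.1
  have hc0 : 0 ≤ c := le_trans (by norm_num) hc.1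
  -- the box's bottom / top Fermi energies at this (a, b, c)
  have hlo := (fermiEnergyOf_mem_Icc_of_mem_box' (Δ₁ := ((7 : ℝ) / 5)) (Δ₂ := ((5 : ℝ) / 2)) (a₁ := ((28 : ℝ) / 25)) (a₂ := ((33 : ℝ) / 25)) (b₁ := ((16 : ℝ) / 25)) (b₂ := ((17 : ℝ) / 20)) (c₁ := ((161 : ℝ) / 1000)) (c₂ := ((26 : ℝ) / 125))
    (Δ := ((5 : ℝ) / 2)) (ν := ((21 : ℝ) / 50)) (by norm_num) (by norm_num) (by norm_num) (by norm_num) ⟨by norm_num, le_rfl⟩ ha hb hc (by norm_num) (by norm_num)).1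
  have hhi := (fermiEnergyOf_mem_Icc_of_mem_box' (Δ₁ := ((7 : ℝ) / 5)) (Δ₂ := ((5 : ℝ) / 2)) (a₁ := ((28 : ℝ) / 25)) (a₂ := ((33 : ℝ) / 25)) (b₁ := ((16 : ℝ) / 25)) (b₂ := ((17 : ℝ) / 20)) (c₁ := ((161 : ℝ) / 1000)) (c₂ := ((26 : ℝ) / 125))
    (Δ := ((7 : ℝ) / 5)) (ν := ((21 : ℝ) / 50)) (by norm_num) (by norm_num) (by norm_num) (by norm_num) ⟨le_rfl, by norm_num⟩ ha hb hc (by norm_num) (by norm_num)).2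
  -- the axis ceiling at this (a, c) is below the corner value
  have hW : dWeightAxisCF ((5 : ℝ) / 2) a c ((5877 : ℝ) / 5000) ≤ dWeightAxisCF ((5 : ℝ) / 2) ((28 : ℝ) / 25) ((26 : ℝ) / 125) ((5877 : ℝ) / 5000) :=
    calc dWeightAxisCF ((5 : ℝ) / 2) a c ((5877 : ℝ) / 5000) ≤ dWeightAxisCF ((5 : ℝ) / 2) ((28 : ℝ) / 25) c ((5877 : ℝ) / 5000) :=
          dWeightAxisCF_anti_tpd (by norm_num) (by norm_num) ha.1 (by norm_num) hc0 (by nlinarith [hc.2])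
      _ ≤ dWeightAxisCF ((5 : ℝ) / 2) ((28 : ℝ) / 25) ((26 : ℝ) / 125) ((5877 : ℝ) / 5000) := dWeightAxisCF_mono_tppP (by norm_num) (by norm_num) hc0 hc.2 (by norm_num)
  have hWn : dWeightAxisCF ((5 : ℝ) / 2) ((28 : ℝ) / 25) ((26 : ℝ) / 125) ((5877 : ℝ) / 5000) ≤ ((3181 : ℝ) / 4000) := by norm_num [dWeightAxisCF]
  exact fermiEnergyOf_slope_law (Elow := ((5877 : ℝ) / 5000)) (El := ((5927 : ℝ) / 5000)) (Eh := ((399 : ℝ) / 200)) (by norm_num) (by norm_num) ha0.ne' hc0 ((hc.2.trans (by norm_num)).trans hb.1)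
    (lt_of_lt_of_le (by norm_num) hb.1) (by norm_num) (by norm_num) (by norm_num) (by norm_num) (hF.1.trans hlo) (hhi.trans hT.2)
    (by nlinarith [hc.2, ha.1]) (by nlinarith [hc.2, ha.1]) (by nlinarith [hc.2, ha.1]) (by norm_num) (by linarith)

end Summit.Ventures.CertifiedManyBodySolver.Downfold.Emery
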